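import Summits.KontsevichZagierPeriods.KontsevichZagierPeriods.Theorems.RootDecompRationalCubeDichotomyNashMultiGenP17

/-! # `RootDecompRationalCubeDichotomyNashMultiGenP18` — part 2/3 of the mechanical ≤360-line split of `src.lean`
(split by the decomp-kz census seat for landing; mathematics unchanged; part 2 continues part 1). -/

open Set MvPolynomial Filter Topology
open Literature.NumberTheory.Transcendental (IsSemialgebraicFunOn)
open Literature.ModelTheory.ExponentialFields (IsSemialgebraic isSemialgebraic_setOf_eval_pos
  isSemialgebraic_setOf_eval_ne_zero)

namespace Summit.KontsevichZagierPeriods.RootDecompRationalCubeDichotomy.Rung29430.MultiGen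
open Summit.KontsevichZagierPeriods.KontsevichZagierPeriods.Theses.RootDecompRationalCubeDichotomy
  (NashEtaleCover NashEtaleLocal PiRationalisation)
open Summit.KontsevichZagierPeriods.RootDecompRationalCubeDichotomy.Rung29430.NashEtaleLocalGlue
  (local_of_simple nashEtaleCover_of_nashEtaleLocal nashEtaleLocal_zero)
open Summit.KontsevichZagierPeriods.RootDecompRationalCubeDichotomy.Rung29430.NashEtaleLocalOne
  (analyticOnNhd_aeval_snoc)
open Summit.KontsevichZagierPeriods.RootDecompRationalCubeDichotomy.RungEtale.Etale
  (piRationalisation_of_nashEtaleCover)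

noncomputable section

section OriginOne
open Literature.NumberTheory.Transcendental Literature.ModelTheory.ExponentialFields
open Function
open scoped Polynomial.Bivariate
variable {K : Type} [CommRing K] [Algebra K ℝ]

/-- **(K4) Minimal relation and order of vanishing.**  For `f` `K`-semialgebraic and analytic on
`I = (a, b) ∋ 0` there is `Q ∈ K[X][Y]` with `Q(s, f s) = 0` on `I` and
`∂_w Q (s, f s) = s ^ d · ψ s` near `0`, `ψ` analytic at `0`, `ψ 0 ≠ 0`.  (`Q` of least
`w`-degree among the relations with `Q^ℝ ≠ 0`: then `∂_w Q` is not a relation, and the analytic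
function `s ↦ ∂_w Q(s, f s)` on the interval `I` is not identically zero near `0`.) -/
theorem exists_relation_order {a b : ℝ} {f : ℝ → ℝ} (h0 : (0:ℝ) ∈ Set.Ioo a b)
    (hf : IsSemialgebraicFunOn K {t : Fin 1 → ℝ | t 0 ∈ Set.Ioo a b} (fun t => f (t 0)))
    (han : ∀ x ∈ Set.Ioo a b, AnalyticAt ℝ f x) :
    ∃ (Q : Polynomial (Polynomial K)) (d : ℕ) (ψ : ℝ → ℝ),
      (∀ s ∈ Set.Ioo a b, (bivR Q).evalEval s (f s) = 0) ∧
      AnalyticAt ℝ ψ 0 ∧ ψ 0 ≠ 0 ∧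
      ∀ᶠ s in 𝓝 (0:ℝ), (Polynomial.derivative (bivR Q)).evalEval s (f s) = s ^ d * ψ s := by
  classical
  -- admissible relations: `Q^ℝ ≠ 0` and `Q(s, f s) = 0` on `I`
  let Rel : Polynomial (Polynomial K) → Prop := fun Q =>
    bivR Q ≠ 0 ∧ ∀ s ∈ Set.Ioo a b, (bivR Q).evalEval s (f s) = 0
  -- (K4₀): an admissible relation exists
  have hex : ∃ m, ∃ Q, Rel Q ∧ (bivR Q).natDegree = m := by
    obtain ⟨P, hP, hPf⟩ := exists_relationK hf
    refine ⟨_, toBiv P, ⟨?_, fun s hs => ?_⟩, rfl⟩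
    · obtain ⟨y, hy⟩ := exists_aeval_ne_zero_of_map_ne_zero hP
      intro h0'
      apply hy
      have hyy : y = ![y 0, y 1] := by
        funext i
        fin_cases i <;> rfl
      rw [hyy, ← evalEval_bivR_toBiv, h0', Polynomial.evalEval_zero]
    · have h := hPf (fun _ => s) hs
      have hsn : (Fin.snoc (fun _ : Fin 1 => s) (f s) : Fin (1 + 1) → ℝ) = ![s, f s] := by
        funext i
        fin_cases i <;> rfl
      rw [evalEval_bivR_toBiv, ← hsn]
      exact h
  obtain ⟨Q, hQ, hQm⟩ := Nat.find_spec hex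
  have hmin : ∀ Q', Rel Q' → (bivR Q).natDegree ≤ (bivR Q').natDegree := fun Q' h' => by
    rw [hQm]
    exact Nat.find_min' hex ⟨Q', h', rfl⟩
  -- `deg_w Q^ℝ ≥ 1`: a `w`-free relation `r(t)` would vanish on the infinite set `I`
  have hdeg : (bivR Q).natDegree ≠ 0 := by
    intro hd
    apply hQ.1
    have hC := Polynomial.eq_C_of_natDegree_eq_zero hd
    have hroots : (bivR Q).coeff 0 = 0 := by
      apply Polynomial.eq_zero_of_infinite_isRoot
      refine Set.Infinite.mono (fun s hs => ?_) (Set.Ioo_infinite (h0.1.trans h0.2))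
      have h1 := hQ.2 s hs
      rw [hC, Polynomial.evalEval_C] at h1
      exact h1
    rw [hC, hroots, map_zero]
  -- minimality: `∂_w Q` is not a relation on `I`
  have hDne : ¬ ∀ s ∈ Set.Ioo a b,
      (Polynomial.derivative (bivR Q)).evalEval s (f s) = 0 := by
    intro hall
    have hD0 : Polynomial.derivative (bivR Q) = 0 := by
      by_contra hne
      have hrel : Rel (Polynomial.derivative Q) := by
        refine ⟨?_, fun s hs => ?_⟩
        · rw [bivR_derivative]
          exact hne
        · rw [bivR_derivative]
          exact hall s hs
      have h1 := hmin _ hrel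
      rw [bivR_derivative] at h1
      exact absurd (Polynomial.natDegree_derivative_lt hdeg) (not_lt.mpr h1)
    exact hdeg (Polynomial.derivative_eq_zero.mp hD0)
  -- order of vanishing at `0` of the analytic function `s ↦ ∂_w Q(s, f s)` on the interval
  have hDan : ∀ x ∈ Set.Ioo a b,
      AnalyticAt ℝ (fun s => (Polynomial.derivative (bivR Q)).evalEval s (f s)) x :=
    fun x hx => analyticAt_evalEval _ (han x hx)
  have hnot : ¬ ∀ᶠ s in 𝓝 (0:ℝ), (Polynomial.derivative (bivR Q)).evalEval s (f s) = 0 := by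
    intro hev
    apply hDne
    intro s hs
    exact AnalyticOnNhd.eqOn_zero_of_preconnected_of_eventuallyEq_zero hDan isPreconnected_Ioo
      h0 hev hs
  obtain ⟨d, ψ, hψan, hψ0, hψ⟩ := (hDan 0 h0).exists_eventuallyEq_pow_smul_nonzero_iff.mpr hnot
  refine ⟨Q, d, ψ, hQ.2, hψan, hψ0, ?_⟩
  filter_upwards [hψ] with s hs
  rw [sub_zero, smul_eq_mul] at hs
  exact hs

/-! #### §8.5 The division step (K5) -/

/-- The substituted polynomial `W := Σ_{i < d+2} yᵢ tⁱ ∈ K[y][t]` (`y = (z₀, …, z_d, U)`). -/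
def Wpoly (d : ℕ) : Polynomial (MvPolynomial (Fin (d + 2)) K) :=
  ∑ i : Fin (d + 2), Polynomial.C (MvPolynomial.X i) * Polynomial.X ^ (i : ℕ)

/-- Auxiliary step `eval_spec_Wpoly`. [bookkeeping] -/
theorem eval_spec_Wpoly (d : ℕ) (y : Fin (d + 2) → ℝ) (s : ℝ) :
    (spec y (Wpoly (K := K) d)).eval s = ∑ i : Fin (d + 2), y i * s ^ (i : ℕ) := by
  simp [spec, Wpoly, Polynomial.eval_finsetSum, Polynomial.map_sum]

/-- Auxiliary step `eval_spec_Wpoly_snoc`. [bookkeeping] -/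
theorem eval_spec_Wpoly_snoc (d : ℕ) (c : Fin (d + 1) → ℝ) (U s : ℝ) :
    (spec (Fin.snoc c U) (Wpoly (K := K) d)).eval s =
      ∑ i : Fin (d + 1), c i * s ^ (i : ℕ) + U * s ^ (d + 1) := by
  rw [eval_spec_Wpoly, Fin.sum_univ_castSucc]
  simp

/-- **(K5) The division step.**  From a relation `Q` with `∂_w Q(s, f s) = s^d ψ(s)`, `ψ 0 ≠ 0`,
build the identified system at the origin (see the head of §8). -/
theorem originPointDataExists_of_order (G : (Fin 1 → ℝ) → ℝ) {a b : ℝ} (h0 : (0:ℝ) ∈ Set.Ioo a b)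
    (hf : IsSemialgebraicFunOn K {t : Fin 1 → ℝ | t 0 ∈ Set.Ioo a b} (fun t => G (fun _ => t 0)))
    (han : ∀ x ∈ Set.Ioo a b, AnalyticAt ℝ (fun s : ℝ => G (fun _ => s)) x)
    (Q : Polynomial (Polynomial K)) (d : ℕ) (ψ : ℝ → ℝ)
    (hQ : ∀ s ∈ Set.Ioo a b, (bivR Q).evalEval s (G fun _ => s) = 0)
    (hψan : AnalyticAt ℝ ψ 0) (hψ0 : ψ 0 ≠ 0)
    (hDw : ∀ᶠ s in 𝓝 (0:ℝ),
      (Polynomial.derivative (bivR Q)).evalEval s (G fun _ => s) = s ^ d * ψ s) :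
    OriginPointDataExists K 1 G := by
  set f : ℝ → ℝ := fun s => G (fun _ => s) with hfdef
  set R := bivR Q with hR
  have hImem : Set.Ioo a b ∈ 𝓝 (0:ℝ) := Ioo_mem_nhds h0.1 h0.2
  have hGf : ∀ t : Fin 1 → ℝ, G t = f (t 0) := by
    intro t
    simp only [hfdef]
    congr 1
    funext i
    rw [Subsingleton.elim i 0]
  /- Taylor data: `f s = Σ_{i ≤ d} cᵢ sⁱ + s^{d+1} u(s)` -/
  set u : ℝ → ℝ := (swap dslope (0:ℝ))^[d + 1] f with hu
  set c : Fin (d + 1) → ℝ := fun i => (swap dslope (0:ℝ))^[(i : ℕ)] f 0 with hc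
  have huan : ∀ x ∈ Set.Ioo a b, AnalyticAt ℝ u x := analyticAt_iterate_dslope_zero h0 han (d + 1)
  have htaylor : ∀ s, f s = ∑ i : Fin (d + 1), c i * s ^ (i : ℕ) + s ^ (d + 1) * u s := by
    intro s
    have h := taylor_iterate_dslope_zero f (d + 1) s
    rw [Finset.sum_range] at h
    exact h
  /- (K3): simple-root polynomials `Mᵢ ∈ K[z]` for the Taylor coefficients `cᵢ` -/
  have hM : ∀ i : Fin (d + 1), ∃ M : Polynomial K, Polynomial.aeval (c i) M = 0 ∧
      Polynomial.aeval (c i) (Polynomial.derivative M) ≠ 0 := fun i =>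
    exists_simpleRoot_apply_zeroK (u := (swap dslope (0:ℝ))^[(i : ℕ)] f) h0
      (isSemialgebraicFunOn_iterate_dslope_zeroK h0 hf han i)
  choose M hM0 hM1 using hM
  /- the system: unknowns `y = (z₀, …, z_d, U) ∈ ℝ^{d+2}` -/
  set W : Polynomial (MvPolynomial (Fin (d + 2)) K) := Wpoly d with hW
  set Fpre : Polynomial (MvPolynomial (Fin (d + 2)) K) :=
    Polynomial.aevalAeval Polynomial.X W Q with hFpre
  set Fl : MvPolynomial (Fin (1 + (d + 2))) K :=
    toMv (d + 2) (Fpre /ₘ Polynomial.X ^ (2 * d + 1)) with hFl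
  set F : Fin (d + 2) → MvPolynomial (Fin (1 + (d + 2))) K := Fin.snoc
    (fun i : Fin (d + 1) =>
      Polynomial.aeval (MvPolynomial.X (Fin.natAdd 1 (Fin.castSucc i))) (M i)) Fl with hF
  set y₀ : Fin (d + 2) → ℝ := Fin.snoc c (u 0) with hy₀
  set usol : Fin (d + 2) → (Fin 1 → ℝ) → ℝ :=
    Fin.snoc (fun i _ => c i) (fun t => u (t 0)) with husol
  /- the specialised polynomials `Φ_U(t) := Q(t, W_{(c,U)}(t)) ∈ ℝ[t]` -/
  set Φ : ℝ → Polynomial ℝ := fun U => spec (Fin.snoc c U) Fpre with hΦ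
  have hΦeval : ∀ U s, (Φ U).eval s = R.evalEval s (f s + s ^ (d + 1) * (U - u s)) := by
    intro U s
    simp only [hΦ, hFpre, hW]
    rw [eval_spec_aevalAeval, eval_spec_Wpoly_snoc, htaylor s]
    congr 1
    ring
  /- the Hasse coefficients `H_j(s) := (H_j R)(s, f s)` and the quotient function `h_U` -/
  set H : ℕ → ℝ → ℝ := fun j s => (Polynomial.hasseDeriv j R).evalEval s (f s) with hH
  have hHan : ∀ j, AnalyticAt ℝ (H j) 0 := fun j => analyticAt_evalEval _ (han 0 h0)
  set m := R.natDegree with hm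
  set hfun : ℝ → ℝ → ℝ := fun U s => ψ s * (U - u s) +
    ∑ i ∈ Finset.range m, H (i + 2) s * (s ^ ((d + 1) * i + 1) * (U - u s) ^ (i + 2)) with hhfun
  have hΦev : ∀ U, ∀ᶠ s in 𝓝 (0:ℝ), (Φ U).eval s = s ^ (2 * d + 1) * hfun U s := by
    intro U
    filter_upwards [hDw, hImem] with s hs1 hsI
    rw [hΦeval, evalEval_taylor_split, hQ s hsI, hs1]
    exact division_identity s (ψ s) (U - u s) d m (fun j => H j s)
  have hfun_an : ∀ U, AnalyticAt ℝ (hfun U) 0 := by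
    intro U
    have hu0 : AnalyticAt ℝ u 0 := huan 0 h0
    have hv : AnalyticAt ℝ (fun s => U - u s) 0 := analyticAt_const.sub hu0
    refine (hψan.mul hv).add ?_
    refine Finset.analyticAt_fun_sum _ fun i _ => ?_
    exact (hHan (i + 2)).mul ((analyticAt_id.pow _).mul (hv.pow _))
  have hval : ∀ U, hfun U 0 = ψ 0 * (U - u 0) := by
    intro U
    simp [hhfun]
  have hdvd : ∀ U, Polynomial.X ^ (2 * d + 1) ∣ Φ U := fun U =>
    X_pow_dvd_of_eventually_eq (hfun_an U).continuousAt (hΦev U)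
  have hΦ0 : ∀ U, (Φ U /ₘ Polynomial.X ^ (2 * d + 1)).eval 0 = ψ 0 * (U - u 0) := fun U => by
    rw [eval_divByMonic_zero_of_eventually (hfun_an U).continuousAt (hΦev U), hval]
  /- evaluation of the equations -/
  have hFl_eval : ∀ (t : Fin 1 → ℝ) (U : ℝ),
      MvPolynomial.aeval (Fin.append t (Fin.snoc c U)) Fl =
        (Φ U /ₘ Polynomial.X ^ (2 * d + 1)).eval (t 0) := by
    intro t U
    rw [hFl, aeval_append_toMv, spec_divByMonic_X_pow]
  have hFcs : ∀ (x : Fin (1 + (d + 2)) → ℝ) (i : Fin (d + 1)),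
      MvPolynomial.aeval x (F (Fin.castSucc i)) =
        Polynomial.aeval (x (Fin.natAdd 1 (Fin.castSucc i))) (M i) := by
    intro x i
    rw [hF, Fin.snoc_castSucc, aeval_polynomial_aeval_X]
  have hFlast : F (Fin.last (d + 1)) = Fl := by rw [hF, Fin.snoc_last]
  have husol_t : ∀ t : Fin 1 → ℝ, (fun j => usol j t) = Fin.snoc c (u (t 0)) := by
    intro t
    funext j
    refine Fin.lastCases ?_ (fun i => ?_) j
    · simp [husol]
    · simp [husol]
  /- the Jacobian entries at `(0; c, u 0)` -/
  have hrow_cs : ∀ (i : Fin (d + 1)) (j : Fin (d + 2)),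
      MvPolynomial.aeval (Fin.append (0 : Fin 1 → ℝ) y₀) (pderiv (Fin.natAdd 1 j)
        (F (Fin.castSucc i))) =
        if j = Fin.castSucc i then Polynomial.aeval (c i) (Polynomial.derivative (M i)) else 0 := by
    intro i j
    apply aeval_pderiv_eq_of_hasDerivAt
    simp only [update_append_natAdd, hFcs, Fin.append_right]
    split_ifs with hj
    · subst hj
      simp only [Function.update_self, hy₀, Fin.snoc_castSucc]
      exact Polynomial.hasDerivAt_aeval (M i) (c i)
    · simp only [Function.update_of_ne (Ne.symm hj)]
      exact hasDerivAt_const _ _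
  have hlast : MvPolynomial.aeval (Fin.append (0 : Fin 1 → ℝ) y₀)
      (pderiv (Fin.natAdd 1 (Fin.last (d + 1))) (F (Fin.last (d + 1)))) = ψ 0 := by
    apply aeval_pderiv_eq_of_hasDerivAt
    rw [hFlast]
    simp only [update_append_natAdd, Fin.append_right, hy₀, Fin.update_snoc_last, Fin.snoc_last,
      hFl_eval, Pi.zero_apply, hΦ0]
    have h := ((hasDerivAt_id (u 0)).sub_const (u 0)).const_mul (ψ 0)
    simpa using h
  /- assemble -/
  refine ⟨d + 2, y₀, F, toMv (d + 2) W, 1, ?_, ?_, ?_, {t | t 0 ∈ Set.Ioo a b}, usol,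
    isOpen_Ioo.preimage (continuous_apply 0), h0, ?_, ?_, ?_, ?_⟩
  · -- `F(0, y₀) = 0`
    intro i
    refine Fin.lastCases ?_ (fun i => ?_) i
    · rw [hFlast, hy₀, hFl_eval, Pi.zero_apply, hΦ0, sub_self, mul_zero]
    · rw [hFcs, Fin.append_right, hy₀, Fin.snoc_castSucc]
      exact hM0 i
  · -- the Jacobian is lower-triangular with non-zero diagonal
    have htri : (Matrix.of fun i j : Fin (d + 2) =>
        MvPolynomial.aeval (Fin.append (0 : Fin 1 → ℝ) y₀) (pderiv (Fin.natAdd 1 j) (F i))).BlockTriangular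
        OrderDual.toDual := by
      intro i j hij
      have hij' : i < j := hij
      obtain ⟨i', rfl⟩ := Fin.exists_castSucc_eq.mpr (Fin.ne_last_of_lt hij')
      rw [Matrix.of_apply, hrow_cs, if_neg]
      rintro rfl
      exact lt_irrefl _ hij'
    rw [Matrix.det_of_lowerTriangular _ htri, Fin.prod_univ_castSucc]
    simp only [Matrix.of_apply]
    rw [hlast]
    refine mul_ne_zero (Finset.prod_ne_zero_iff.mpr fun i _ => ?_) hψ0
    rw [hrow_cs, if_pos rfl]
    exact hM1 i
  · -- `B = 1`
    rw [map_one]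
    exact one_ne_zero
  · -- `u(0) = y₀`
    intro j
    have h := congrFun (husol_t 0) j
    simp only [Pi.zero_apply] at h
    rw [h, hy₀]
  · -- analyticity of the solution
    intro j
    refine Fin.lastCases ?_ (fun i => ?_) j
    · have hl : usol (Fin.last (d + 1)) = fun t => u (t 0) := by simp [husol]
      rw [hl]
      intro t ht
      have hp : AnalyticAt ℝ (fun t : Fin 1 → ℝ => t 0) t :=
        (ContinuousLinearMap.proj (R := ℝ) (φ := fun _ : Fin 1 => ℝ) 0).analyticAt t
      exact AnalyticAt.comp_of_eq (g := u) (f := fun t : Fin 1 → ℝ => t 0) (huan (t 0) ht) hp rfl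
    · have hl : usol (Fin.castSucc i) = fun _ => c i := by simp [husol]
      rw [hl]
      exact analyticOnNhd_const
  · -- the solution solves the system on `V`
    intro t ht i
    rw [husol_t t]
    refine Fin.lastCases ?_ (fun i => ?_) i
    · rw [hFlast, hFl_eval]
      by_cases hs : t 0 = 0
      · rw [hs, hΦ0, sub_self, mul_zero]
      · have h1 := pow_mul_eval_divByMonic (hdvd (u (t 0))) (t 0)
        rw [hΦeval, sub_self, mul_zero, add_zero] at h1
        have h2 : f (t 0) = G (fun _ => t 0) := rfl
        rw [h2, hQ (t 0) ht] at h1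
        exact (mul_eq_zero.mp h1).resolve_left (pow_ne_zero _ hs)
    · rw [hFcs, Fin.append_right, Fin.snoc_castSucc]
      exact hM0 i
  · -- `G = A / B` along the solution
    intro t _
    rw [husol_t t, map_one, div_one, aeval_append_toMv, hW, eval_spec_Wpoly_snoc, hGf t,
      htaylor (t 0)]
    ring

/-! #### §8.6 `OriginNashExists 1` and the corollaries `SliceNash 1`, item 33041 -/

end OriginOne
end
end Summit.KontsevichZagierPeriods.RootDecompRationalCubeDichotomy.Rung29430.MultiGen
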